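import Literature.MathematicalPhysics.QuantumFieldTheory.Balaban1983to89.Beta.BlochFibreMatrix
import Literature.MathematicalPhysics.QuantumFieldTheory.Balaban1983to89.Beta.KernelRepresentationSummable

/-!
# The infinite-volume solution operator of the TYPED `U = 1` block-averaging KKT system AS A KERNEL-REPRESENTED `InfiniteVolumeSpec` — the instance

Literature / mathematical physics / constructive QFT / Bałaban 1983–89, β-function sub-cell (row BETA-an2, background-
field route), item **(D4)(iii)** of the kernel route P1-K (cell RULING (R13-2)/(R14-1)).

HONEST FRAMING.  Discharging `BetaPertH` makes Bałaban's UV stability UNCONDITIONAL — a real constructive-QFT result;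
it is NOT the continuum limit and NOT the Clay problem.  This file is `[folklore]` linear algebra and elementary
analysis (absolutely convergent lattice sums); it cites nothing and asserts nothing about Bałaban's papers.  Its value
is kernel bookkeeping: it CONSTRUCTS the object whose existence the cell's normalisation chain
(`Beta/KernelRepresentationSummable.lowMomentsSum_of_spec`, `Beta/DressedMomentNormalisation`) takes as a hypothesis.

READING, NOT A THEOREM OF THIS FILE: the identification of this typed system and its solution operator with Bałaban's
`U = 1` gauge-fixed constrained minimiser (the variational problem `inf ½⟨dA, dA⟩` under `Q_k A = B`, `R d^*A = 0` and
its Lagrange-multiplier equations, [Balaban1984PropagatorsI, p. 26, (1.47)–(1.50)]; background-field form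
[Balaban1985BackgroundPropagators, p. 394, (3.20)–(3.24)]) is a READING maintained by the sub-cell's literature rows —
it is NOT proved here, NOT cited as a fact, and NEVER used as a hypothesis; those pointers are context only.

## What is constructed

For every block side `N ≥ 1` and every dimension `d + 1 ≥ 1` we build

* real matrix kernels `wH κ l`, `wΦ κ l`, `wM l : ℤ^{d+1} → ℝ` — the real parts of the A-field, the constraint
  multiplier and the gauge multiplier of the FUNDAMENTAL CONFIGURATION `Beta/BlochFibreMatrix.fundCfg (src l)` of
  the gauge-fixed block-averaged KKT system with a unit source in the Q-row `l` (Theorem `fundCfg_solves` there: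
  Euler–Lagrange equation everywhere, block-constant gauge quantity, block averages `δ_{y,0} δ_{κ l}`);
* their EXPONENTIAL DECAY in the `ℓ¹` norm (`decay_wH`, from `Beta/FibreInverseDecay` through
  `BlochFibreMatrix.invKernel_fibre_decay_l1` and the elementary comparison `|z|₁ ≤ N |⌊z/N⌋|₁ + N (d+1)`), hence
  absolutely summable second moments `AbsMoment₂ (wH κ l)` (`absMoment₂_wH`; likewise `wΦ`, `wM`);
* the three maps of an `AffineReproduction.InfiniteVolumeSpec (d+1) N`:
  `H b := kernelOpSum N wH b` (the literal kernel operator `(H b)_κ(x) = Σ_l Σ_y wH_{κl}(x − N y) b_l(y)` of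
  `Beta/KernelRepresentationSummable`), `Φ b := kernelOpSum 1 wΦ b`, `Ψ b := δ d (kernelOpSum N wM b)`;
* **`specK : InfiniteVolumeSpec (d+1) N`** — ALL NINE FIELDS PROVED: additivity and block-translation covariance
  (from `KernelRepresentationSummable.kernelOpSum_H_add/_H_cov`), and the three equations — reproduction of affine
  block averages `Q_H`, the Euler–Lagrange equation `EL` with the multipliers `Φ`, `Ψ`, and the block-constant gauge
  quantity `gauge` — by SUPERPOSITION: every field is an absolutely convergent sum over the sources `(l, y)` of
  translated fundamental columns weighted by `b_l(y)` (`hasSum_Hop`, `hasSum_Φop`, `hasSum_Mop`), every finite-stencil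
  operator passes through such sums termwise (`hasSum_dz`, `hasSum_curv`, …), and each translated column satisfies
  the column identities (`wH_EL`, `wH_G`, `wH_Q`);
* `specK_H : specK.H = kernelOpSum N wH` (by `rfl`) and the END-TO-END consequence
  **`lowMomentsSum_specK`** = `KernelRepresentationSummable.lowMomentsSum_of_spec specK wH absMoment₂_wH rfl`:
  the windowed zeroth and first coset moments of the kernel `wH` of the solution operator of the TYPED `U = 1`
  block-averaging KKT system (`AffineReproduction.InfiniteVolumeSpec`) — the (L0∞)/(L1∞) input of the
  normalisation last mile (`Beta/DressedMomentNormalisation.identityForm_of_kernelFamilies`).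

No `sorry`, no new axioms, no cited facts.  Everything is tagged `[folklore]`.
Version v1.1 (2026-08-19, b2b-balaban-beta-an2-g5): v1 = p183734; v1.1 is a DOCSTRING-ONLY wording fix — «minimiser» ↦
«solution operator of the typed `U = 1` block-averaging KKT system» in the title, the summary and `lowMomentsSum_specK`,
plus the READING paragraph above; no declaration, statement or proof changed.
Version v1.2 (2026-08-19, b2b-balaban-beta-an2-g6): DOCSTRING-ONLY — the `N`-dependence of the decay witnesses is now
stated on `fundCfg_src_decay` / `decay_wH` / `decay_wM` / `decay_wΦ` / `exists_kernelSpec` (δ_N = δ/N, C_N = M·e^{δ(d+1)}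
from `invKernel_fibre_decay_l1 (N := N)`; existential per `N`, no uniformity in `N` claimed or needed — XREAD C-pv01-64
item (d), DOCFIX owed by an2); no declaration, statement or proof changed.
-/

noncomputable section

namespace Literature.MathematicalPhysics.QuantumFieldTheory.Balaban1983to89.Beta.KernelSpecInstance

open Literature.Probability.LatticeModels (TorusSite Torus.proj Torus.proj_apply)
open AffineAveraging (Form0 Form1 Form2 unitVec unitVec_apply dz curv curvAdj codiff₁ box toSite blockSum
  contourSum affine)
open AffineReproduction (trans0 trans1 trans1_apply trans0_apply IsAffine InfiniteVolumeSpec contourSumAdj IsBlockConst)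
open LatticeForm (repZ quo proj_repZ)
open BlochFibreUniqueness (adjContourSum adjContourSum_apply quo_add_zsmul quo_repZ)
open BlochFibreMatrix (Idx Cfg cfgA cfgμ cfgφ shiftCfg stencil pieceMatrix fundCfg fundCfg_solves repZ_nonneg repZ_lt
  eq_repZ_add_zsmul_quo toSite_eq_repZ_proj invKernel_fibre_decay_l1)
open FibreInverseDecay (invKernel)
open KernelRepresentationSummable (kernelOpSum kernelOpSum_apply_eq_decimated summand kernelOpSum_add kernelOpSum_H_add
  kernelOpSum_H_cov kernelOpSum_trans1 summable_summand_of_isAffine lowMomentsSum_of_spec)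
open DecimatedMomentSummable (AbsMoment₂ absMoment₂_of_decay510 ConstReproSum LinReproSum)
open DecimatedMoment (cosetInd)
open B12Sec2to5 (l1 Decay510)

variable {d N : ℕ}

/-! ## §1 Real parts commute with the (integer-coefficient) lattice operators -/

/-- Real part of a complex 0-form. [folklore] -/
def re0 (f : Form0 d ℂ) : Form0 d ℝ := fun x => (f x).re

/-- Real part of a complex 1-form. [folklore] -/
def re1 (A : Form1 d ℂ) : Form1 d ℝ := fun κ x => (A κ x).re

/-- Real part of a complex 2-form. [folklore] -/
def re2 (F : Form2 d ℂ) : Form2 d ℝ := fun κ l x => (F κ l x).re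

/-- Entries of `re0`. [folklore] -/
@[simp] theorem re0_apply (f : Form0 d ℂ) (x : AffineAveraging.Site d) : re0 f x = (f x).re := rfl

/-- Entries of `re1`. [folklore] -/
@[simp] theorem re1_apply (A : Form1 d ℂ) (κ : Fin d) (x : AffineAveraging.Site d) : re1 A κ x = (A κ x).re := rfl

/-- Entries of `re2`. [folklore] -/
@[simp] theorem re2_apply (F : Form2 d ℂ) (κ l : Fin d) (x : AffineAveraging.Site d) : re2 F κ l x = (F κ l x).re := rfl

/-- `Re ∘ d = d ∘ Re` on 0-forms. [folklore] -/
theorem re1_dz (f : Form0 d ℂ) : re1 (dz f) = dz (re0 f) := by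
  funext κ x; simp [dz]

/-- `Re ∘ curv = curv ∘ Re`. [folklore] -/
theorem re2_curv (A : Form1 d ℂ) : re2 (curv A) = curv (re1 A) := by
  funext κ l x; simp [curv]

/-- `Re ∘ curvAdj = curvAdj ∘ Re`. [folklore] -/
theorem re1_curvAdj (F : Form2 d ℂ) : re1 (curvAdj F) = curvAdj (re2 F) := by
  funext μ y; simp [curvAdj, Complex.re_sum]

/-- `Re ∘ δ = δ ∘ Re` on 1-forms. [folklore] -/
theorem re0_codiff₁ (A : Form1 d ℂ) : re0 (codiff₁ A) = codiff₁ (re1 A) := by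
  funext x; simp [codiff₁, Complex.re_sum]

/-- `Re ∘ 𝒬 = 𝒬 ∘ Re` (block contour sums). [folklore] -/
theorem re1_contourSum (A : Form1 d ℂ) : re1 (contourSum N A) = contourSum N (re1 A) := by
  funext κ y; simp [contourSum, Complex.re_sum]

/-- `Re ∘ 𝒬ᵀ = 𝒬ᵀ ∘ Re`: the real part of the generic adjoint contour sum of `Beta/BlochFibreUniqueness` is the
`ℝ`-valued `AffineReproduction.contourSumAdj` (same formula, the block index being the floor quotient). [folklore] -/
theorem re1_adjContourSum (φ : Form1 d ℂ) : re1 (adjContourSum N φ) = contourSumAdj N (re1 φ) := by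
  funext κ x
  simp only [re1_apply, adjContourSum_apply, contourSumAdj, Complex.re_sum]
  rfl

/-! ## §2 Unconditional sums pass through the finite-stencil operators -/

section HasSum

variable {ι : Type*}

/-- `d` of a pointwise `HasSum` family of 0-forms. [folklore] -/
theorem hasSum_dz {F : ι → Form0 d ℝ} {f : Form0 d ℝ} (h : ∀ x, HasSum (fun i => F i x) (f x)) (κ : Fin d)
    (x : AffineAveraging.Site d) : HasSum (fun i => dz (F i) κ x) (dz f κ x) := by
  simp only [dz]; exact (h _).sub (h _)

/-- `curv` of a pointwise `HasSum` family of 1-forms. [folklore] -/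
theorem hasSum_curv {F : ι → Form1 d ℝ} {A : Form1 d ℝ} (h : ∀ κ x, HasSum (fun i => F i κ x) (A κ x))
    (κ l : Fin d) (x : AffineAveraging.Site d) : HasSum (fun i => curv (F i) κ l x) (curv A κ l x) := by
  simp only [curv]; exact (((h _ _).add (h _ _)).sub (h _ _)).sub (h _ _)

/-- `curvAdj` of a pointwise `HasSum` family of 2-forms. [folklore] -/
theorem hasSum_curvAdj {F : ι → Form2 d ℝ} {G : Form2 d ℝ} (h : ∀ κ l x, HasSum (fun i => F i κ l x) (G κ l x))
    (μ : Fin d) (y : AffineAveraging.Site d) : HasSum (fun i => curvAdj (F i) μ y) (curvAdj G μ y) := by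
  simp only [curvAdj]
  exact (hasSum_sum fun l _ => (h _ _ _).sub (h _ _ _)).add (hasSum_sum fun κ _ => (h _ _ _).sub (h _ _ _))

/-- `δ` of a pointwise `HasSum` family of 1-forms. [folklore] -/
theorem hasSum_codiff₁ {F : ι → Form1 d ℝ} {A : Form1 d ℝ} (h : ∀ κ x, HasSum (fun i => F i κ x) (A κ x))
    (x : AffineAveraging.Site d) : HasSum (fun i => codiff₁ (F i) x) (codiff₁ A x) := by
  simp only [codiff₁]; exact hasSum_sum fun κ _ => (h _ _).sub (h _ _)

/-- `𝒬` of a pointwise `HasSum` family of 1-forms. [folklore] -/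
theorem hasSum_contourSum {F : ι → Form1 d ℝ} {A : Form1 d ℝ} (h : ∀ κ x, HasSum (fun i => F i κ x) (A κ x))
    (κ : Fin d) (y : AffineAveraging.Site d) : HasSum (fun i => contourSum N (F i) κ y) (contourSum N A κ y) := by
  simp only [contourSum]; exact hasSum_sum fun b _ => hasSum_sum fun s _ => h _ _

/-- `𝒬ᵀ` of a pointwise `HasSum` family of coarse 1-forms. [folklore] -/
theorem hasSum_contourSumAdj {F : ι → Form1 d ℝ} {φ : Form1 d ℝ} (h : ∀ κ y, HasSum (fun i => F i κ y) (φ κ y))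
    (κ : Fin d) (x : AffineAveraging.Site d) : HasSum (fun i => contourSumAdj N (F i) κ x) (contourSumAdj N φ κ x) := by
  simp only [contourSumAdj]; exact hasSum_sum fun s _ => h _ _

end HasSum

/-! ## §3 The five composite operators as `ℝ`-linear maps, superposition, translation -/

section Operators

/-- `curv` is additive (real forms). [folklore] -/
theorem curv_add (A B : Form1 d ℝ) : curv (A + B) = curv A + curv B := by
  funext κ l x; simp only [curv, Pi.add_apply]; ring

/-- `curv` is homogeneous (real forms). [folklore] -/
theorem curv_smul (a : ℝ) (A : Form1 d ℝ) : curv (a • A) = a • curv A := by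
  funext κ l x; simp only [curv, Pi.smul_apply, smul_eq_mul]; ring

/-- `curvAdj` is additive (real forms). [folklore] -/
theorem curvAdj_add (F G : Form2 d ℝ) : curvAdj (F + G) = curvAdj F + curvAdj G := by
  funext μ y
  simp only [curvAdj, Pi.add_apply, Finset.sum_add_distrib, Finset.sum_sub_distrib]
  ring

/-- `curvAdj` is homogeneous (real forms). [folklore] -/
theorem curvAdj_smul (a : ℝ) (F : Form2 d ℝ) : curvAdj (a • F) = a • curvAdj F := by
  funext μ y
  simp only [curvAdj, Pi.smul_apply, smul_eq_mul]
  rw [mul_add, Finset.mul_sum, Finset.mul_sum]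
  congr 1 <;> exact Finset.sum_congr rfl (fun _ _ => by ring)

/-- `δ` is additive (real 1-forms). [folklore] -/
theorem codiff₁_add (A B : Form1 d ℝ) : codiff₁ (A + B) = codiff₁ A + codiff₁ B := by
  funext x
  simp only [codiff₁, Pi.add_apply, Finset.sum_add_distrib, Finset.sum_sub_distrib]
  ring

/-- `δ` is homogeneous (real 1-forms). [folklore] -/
theorem codiff₁_smul (a : ℝ) (A : Form1 d ℝ) : codiff₁ (a • A) = a • codiff₁ A := by
  funext x
  simp only [codiff₁, Pi.smul_apply, smul_eq_mul]
  rw [Finset.mul_sum]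
  exact Finset.sum_congr rfl (fun _ _ => by ring)

/-- `d` is homogeneous (real 0-forms). [folklore] -/
theorem dz_smul (a : ℝ) (f : Form0 d ℝ) : dz (a • f) = a • dz f := by
  funext κ x; simp only [dz, Pi.smul_apply, smul_eq_mul]; ring

/-- `𝒬` is homogeneous (real forms). [folklore] -/
theorem contourSum_smul (a : ℝ) (A : Form1 d ℝ) : contourSum N (a • A) = a • contourSum N A := by
  funext κ y
  simp only [contourSum, Pi.smul_apply, smul_eq_mul, Finset.mul_sum]

/-- `𝒬ᵀ` is additive. [folklore] -/
theorem contourSumAdj_add (φ ψ : Form1 d ℝ) :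
    contourSumAdj N (φ + ψ) = contourSumAdj N φ + contourSumAdj N ψ := by
  funext κ x
  simp only [contourSumAdj, Pi.add_apply, Finset.sum_add_distrib]

/-- `𝒬ᵀ` is homogeneous. [folklore] -/
theorem contourSumAdj_smul (a : ℝ) (φ : Form1 d ℝ) : contourSumAdj N (a • φ) = a • contourSumAdj N φ := by
  funext κ x
  simp only [contourSumAdj, Pi.smul_apply, smul_eq_mul, Finset.mul_sum]

/-- The block-average operator `𝒬` as an `ℝ`-linear map. [folklore] -/
def opQ (N : ℕ) : Form1 d ℝ →ₗ[ℝ] Form1 d ℝ where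
  toFun A := contourSum N A
  map_add' A B := AffineReproduction.contourSum_add A B
  map_smul' a A := contourSum_smul a A

/-- The Euler–Lagrange operator `d*d` as an `ℝ`-linear map. [folklore] -/
def opEL : Form1 d ℝ →ₗ[ℝ] Form1 d ℝ where
  toFun A := curvAdj (curv A)
  map_add' A B := by simp only [curv_add, curvAdj_add]
  map_smul' a A := by simp only [curv_smul, curvAdj_smul, RingHom.id_apply]

/-- The gauge quantity `δ d δ` as an `ℝ`-linear map. [folklore] -/
def opG : Form1 d ℝ →ₗ[ℝ] Form0 d ℝ where
  toFun A := codiff₁ (dz (codiff₁ A))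
  map_add' A B := by simp only [codiff₁_add, AffineReproduction.dz_add]
  map_smul' a A := by simp only [codiff₁_smul, dz_smul, RingHom.id_apply]

/-- The adjoint block-average operator `𝒬ᵀ` as an `ℝ`-linear map. [folklore] -/
def opΦ (N : ℕ) : Form1 d ℝ →ₗ[ℝ] Form1 d ℝ where
  toFun φ := contourSumAdj N φ
  map_add' φ ψ := contourSumAdj_add φ ψ
  map_smul' a φ := contourSumAdj_smul a φ

/-- The gauge-multiplier operator `d δ d` (on 0-forms) as an `ℝ`-linear map. [folklore] -/
def opM : Form0 d ℝ →ₗ[ℝ] Form1 d ℝ where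
  toFun f := dz (codiff₁ (dz f))
  map_add' f g := by simp only [AffineReproduction.dz_add, codiff₁_add]
  map_smul' a f := by simp only [dz_smul, codiff₁_smul, RingHom.id_apply]

/-- Entries of `opQ`. [folklore] -/
@[simp] theorem opQ_apply (A : Form1 d ℝ) : opQ N A = contourSum N A := rfl

/-- Entries of `opEL`. [folklore] -/
@[simp] theorem opEL_apply (A : Form1 d ℝ) : opEL A = curvAdj (curv A) := rfl

/-- Entries of `opG`. [folklore] -/
@[simp] theorem opG_apply (A : Form1 d ℝ) : opG A = codiff₁ (dz (codiff₁ A)) := rfl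

/-- Entries of `opΦ`. [folklore] -/
@[simp] theorem opΦ_apply (φ : Form1 d ℝ) : opΦ N φ = contourSumAdj N φ := rfl

/-- Entries of `opM`. [folklore] -/
@[simp] theorem opM_apply (f : Form0 d ℝ) : opM f = dz (codiff₁ (dz f)) := rfl

/-- A superposition of 1-forms with scalar weights, written as a `Finset` sum of scalar multiples. [folklore] -/
theorem superpos₁_eq {n : ℕ} (W : Fin n → Form1 d ℝ) (c : Fin n → ℝ) :
    (fun κ z => ∑ l, W l κ z * c l) = ∑ l, c l • W l := by
  funext κ z
  simp only [Finset.sum_apply, Pi.smul_apply, smul_eq_mul]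
  exact Finset.sum_congr rfl fun l _ => mul_comm _ _

/-- A superposition of 0-forms with scalar weights, written as a `Finset` sum of scalar multiples. [folklore] -/
theorem superpos₀_eq {n : ℕ} (W : Fin n → Form0 d ℝ) (c : Fin n → ℝ) :
    (fun z => ∑ l, W l z * c l) = ∑ l, c l • W l := by
  funext z
  simp only [Finset.sum_apply, Pi.smul_apply, smul_eq_mul]
  exact Finset.sum_congr rfl fun l _ => mul_comm _ _

/-- A linear operator on 1-forms, valued in 1-forms, passes through a finite superposition. [folklore] -/
theorem op₁₁_superpos {n : ℕ} (T : Form1 d ℝ →ₗ[ℝ] Form1 d ℝ) (W : Fin n → Form1 d ℝ) (c : Fin n → ℝ)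
    (μ : Fin d) (x : AffineAveraging.Site d) : T (fun κ z => ∑ l, W l κ z * c l) μ x = ∑ l, c l * T (W l) μ x := by
  rw [superpos₁_eq, map_sum]
  simp only [map_smul, Finset.sum_apply, Pi.smul_apply, smul_eq_mul]

/-- A linear operator on 1-forms, valued in 0-forms, passes through a finite superposition. [folklore] -/
theorem op₁₀_superpos {n : ℕ} (T : Form1 d ℝ →ₗ[ℝ] Form0 d ℝ) (W : Fin n → Form1 d ℝ) (c : Fin n → ℝ)
    (x : AffineAveraging.Site d) : T (fun κ z => ∑ l, W l κ z * c l) x = ∑ l, c l * T (W l) x := by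
  rw [superpos₁_eq, map_sum]
  simp only [map_smul, Finset.sum_apply, Pi.smul_apply, smul_eq_mul]

/-- A linear operator on 0-forms, valued in 1-forms, passes through a finite superposition. [folklore] -/
theorem op₀₁_superpos {n : ℕ} (T : Form0 d ℝ →ₗ[ℝ] Form1 d ℝ) (W : Fin n → Form0 d ℝ) (c : Fin n → ℝ)
    (μ : Fin d) (x : AffineAveraging.Site d) : T (fun z => ∑ l, W l z * c l) μ x = ∑ l, c l * T (W l) μ x := by
  rw [superpos₀_eq, map_sum]
  simp only [map_smul, Finset.sum_apply, Pi.smul_apply, smul_eq_mul]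

variable {R : Type*} [CommRing R]

/-- `d` commutes with translations (shift form `z − v`). [folklore] -/
theorem dz_shift (f : Form0 d R) (v : AffineAveraging.Site d) : dz (fun z => f (z - v)) = fun κ z => dz f κ (z - v) := by
  funext κ z; simp only [dz]; rw [add_sub_right_comm]

/-- `δ` commutes with translations (shift form). [folklore] -/
theorem codiff₁_shift (A : Form1 d R) (v : AffineAveraging.Site d) :
    codiff₁ (fun κ z => A κ (z - v)) = fun z => codiff₁ A (z - v) := by
  funext z; simp only [codiff₁]
  exact Finset.sum_congr rfl fun κ _ => by rw [sub_right_comm]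

/-- `curv` commutes with translations (shift form). [folklore] -/
theorem curv_shift (A : Form1 d R) (v : AffineAveraging.Site d) :
    curv (fun κ z => A κ (z - v)) = fun κ l z => curv A κ l (z - v) := by
  funext κ l z; simp only [curv]; rw [add_sub_right_comm z (unitVec κ) v, add_sub_right_comm z (unitVec l) v]

/-- `curvAdj` commutes with translations (shift form). [folklore] -/
theorem curvAdj_shift (F : Form2 d R) (v : AffineAveraging.Site d) :
    curvAdj (fun κ l z => F κ l (z - v)) = fun μ z => curvAdj F μ (z - v) := by
  funext μ z; simp only [curvAdj]
  congr 1
  · exact Finset.sum_congr rfl fun l _ => by rw [sub_right_comm]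
  · exact Finset.sum_congr rfl fun κ _ => by rw [sub_right_comm]

/-- `d*d` commutes with translations (shift form, pointwise). [folklore] -/
theorem opEL_shift (A : Form1 d ℝ) (v : AffineAveraging.Site d) (μ : Fin d) (x : AffineAveraging.Site d) :
    curvAdj (curv (fun κ z => A κ (z - v))) μ x = curvAdj (curv A) μ (x - v) := by
  rw [curv_shift, curvAdj_shift]

/-- `δdδ` commutes with translations (shift form, pointwise). [folklore] -/
theorem opG_shift (A : Form1 d ℝ) (v : AffineAveraging.Site d) (x : AffineAveraging.Site d) :
    codiff₁ (dz (codiff₁ (fun κ z => A κ (z - v)))) x = codiff₁ (dz (codiff₁ A)) (x - v) := by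
  rw [codiff₁_shift, dz_shift, codiff₁_shift]

/-- `dδd` commutes with translations (shift form, pointwise). [folklore] -/
theorem opM_shift (f : Form0 d ℝ) (v : AffineAveraging.Site d) (μ : Fin d) (x : AffineAveraging.Site d) :
    dz (codiff₁ (dz (fun z => f (z - v)))) μ x = dz (codiff₁ (dz f)) μ (x - v) := by
  rw [dz_shift, codiff₁_shift, dz_shift]

/-- `𝒬` of a block-translated 1-form = the coarse translate of `𝒬`. [folklore] -/
theorem contourSum_shift (A : Form1 d R) (y : AffineAveraging.Site d) (κ : Fin d) (y' : AffineAveraging.Site d) :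
    contourSum N (fun l z => A l (z - (N : ℤ) • y)) κ y' = contourSum N A κ (y' - y) := by
  simp only [contourSum]
  refine Finset.sum_congr rfl (fun b _ => Finset.sum_congr rfl (fun s _ => ?_))
  congr 1
  rw [smul_sub]
  abel

/-- `𝒬ᵀ` of a coarse-translated coarse 1-form = the block translate of `𝒬ᵀ`. [folklore] -/
theorem contourSumAdj_shift [NeZero N] (φ : Form1 d ℝ) (y : AffineAveraging.Site d) (κ : Fin d) (x : AffineAveraging.Site d) :
    contourSumAdj N (fun l q => φ l (q - y)) κ x = contourSumAdj N φ κ (x - (N : ℤ) • y) := by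
  simp only [contourSumAdj]
  refine Finset.sum_congr rfl (fun s _ => ?_)
  congr 1
  have h := quo_add_zsmul (N := N) (x - (s : ℤ) • unitVec κ) (-y)
  funext i
  have hi := congr_fun h i
  simp only [quo, Pi.add_apply, Pi.sub_apply, Pi.neg_apply, Pi.smul_apply, smul_eq_mul] at hi ⊢
  rw [show x i - (N : ℤ) * y i - (s : ℤ) * unitVec κ i = x i - (s : ℤ) * unitVec κ i + (N : ℤ) * -y i by ring, hi]
  ring

end Operators

/-! ## §4 Unit sources, the fundamental columns and their real kernels -/

section Columns

/-- The unit source in the Q-row `l`. [folklore] -/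
def src (l : Fin (d + 1)) : Idx (d + 1) N → ℂ := fun i => if i = Sum.inr (Sum.inr l) then 1 else 0

/-- The unit source vanishes on the EL rows. [folklore] -/
@[simp] theorem src_inl (l κ : Fin (d + 1)) (z : TorusSite (d + 1) N) : src (N := N) l (Sum.inl (κ, z)) = 0 := by
  simp [src]

/-- The unit source vanishes on the G/M rows. [folklore] -/
@[simp] theorem src_inr_inl (l : Fin (d + 1)) (z : TorusSite (d + 1) N) :
    src (N := N) l (Sum.inr (Sum.inl z)) = 0 := by
  simp [src]

/-- The unit source on the Q rows. [folklore] -/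
@[simp] theorem src_inr_inr (l κ : Fin (d + 1)) :
    src (N := N) l (Sum.inr (Sum.inr κ)) = if κ = l then 1 else 0 := by
  simp [src]

variable [NeZero N]

/-- A matrix applied to the unit source reads off one column. [folklore] -/
theorem mulVec_src (K : Matrix (Idx (d + 1) N) (Idx (d + 1) N) ℂ) (l : Fin (d + 1)) (i : Idx (d + 1) N) :
    K.mulVec (src l) i = K i (Sum.inr (Sum.inr l)) := by
  simp [Matrix.mulVec, dotProduct, src]

/-- The A-field of the fundamental configuration with unit source in Q-row `l` (complex-valued). [folklore] -/
def colA (l : Fin (d + 1)) : Form1 (d + 1) ℂ := cfgA (fundCfg (N := N) (src l))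

/-- The constraint multiplier of the fundamental configuration with unit source in Q-row `l`. [folklore] -/
def colφ (l : Fin (d + 1)) : Form1 (d + 1) ℂ := cfgφ (fundCfg (N := N) (src l))

/-- The gauge multiplier of the fundamental configuration with unit source in Q-row `l`. [folklore] -/
def colμ (l : Fin (d + 1)) : Form0 (d + 1) ℂ := cfgμ (fundCfg (N := N) (src l))

/-- COLUMN IDENTITY (EL): the Euler–Lagrange equation of the fundamental column. [folklore] -/
theorem colA_EL (l : Fin (d + 1)) :
    curvAdj (curv (colA (N := N) l)) = adjContourSum N (colφ (N := N) l) + dz (codiff₁ (dz (colμ (N := N) l))) :=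
  (fundCfg_solves (N := N) (src l) (by simp) (by simp)).1

/-- COLUMN IDENTITY (G): the gauge quantity of the fundamental column is block-constant. [folklore] -/
theorem colA_G (l : Fin (d + 1)) (y : AffineAveraging.Site (d + 1)) (z : TorusSite (d + 1) N) :
    codiff₁ (dz (codiff₁ (colA (N := N) l))) (repZ z + (N : ℤ) • y)
      = codiff₁ (dz (codiff₁ (colA (N := N) l))) ((N : ℤ) • y) :=
  (fundCfg_solves (N := N) (src l) (by simp) (by simp)).2.1 y z

/-- COLUMN IDENTITY (Q): the block averages of the fundamental column are `δ_{y,0} δ_{κ,l}`. [folklore] -/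
theorem colA_Q (l κ : Fin (d + 1)) (y : AffineAveraging.Site (d + 1)) :
    contourSum N (colA (N := N) l) κ y = if y = 0 ∧ κ = l then 1 else 0 := by
  have h := (fundCfg_solves (N := N) (src l) (by simp) (by simp)).2.2.2 κ y
  rw [colA, h, src_inr_inr]
  by_cases hy : y = 0 <;> by_cases hκ : κ = l <;> simp [hy, hκ]

/-- THE REAL KERNEL of the fine field: `wH κ l z = Re A^{(l)}_κ(z)`. [folklore] -/
def wH (κ l : Fin (d + 1)) (z : AffineAveraging.Site (d + 1)) : ℝ := (colA (N := N) l κ z).re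

/-- THE REAL KERNEL of the constraint multiplier: `wΦ κ l y = Re φ^{(l)}_κ(y)`. [folklore] -/
def wΦ (κ l : Fin (d + 1)) (y : AffineAveraging.Site (d + 1)) : ℝ := (colφ (N := N) l κ y).re

/-- THE REAL KERNEL of the gauge multiplier: `wM l z = Re μ^{(l)}(z)`. [folklore] -/
def wM (l : Fin (d + 1)) (z : AffineAveraging.Site (d + 1)) : ℝ := (colμ (N := N) l z).re

/-- `wH · l` is the real part of the column `A^{(l)}`. [folklore] -/
theorem re1_colA (l : Fin (d + 1)) : re1 (colA (N := N) l) = fun κ z => wH (N := N) κ l z := rfl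

/-- `wΦ · l` is the real part of the column `φ^{(l)}`. [folklore] -/
theorem re1_colφ (l : Fin (d + 1)) : re1 (colφ (N := N) l) = fun κ y => wΦ (N := N) κ l y := rfl

/-- `wM l` is the real part of the column `μ^{(l)}`. [folklore] -/
theorem re0_colμ (l : Fin (d + 1)) : re0 (colμ (N := N) l) = wM (N := N) l := rfl

/-- REAL COLUMN IDENTITY (EL), pointwise. [folklore] -/
theorem wH_EL (l μ : Fin (d + 1)) (x : AffineAveraging.Site (d + 1)) :
    curvAdj (curv (fun κ z => wH (N := N) κ l z)) μ x
      = contourSumAdj N (fun κ y => wΦ (N := N) κ l y) μ x + dz (codiff₁ (dz (wM (N := N) l))) μ x := by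
  have h := congrArg re1 (colA_EL (N := N) l)
  -- `h : re1 (curvAdj (curv colA)) = re1 (adjContourSum … + dz …)`; push `re1` through every operator
  have h' := congr_fun (congr_fun h μ) x
  simp only [re1_apply, Pi.add_apply, Complex.add_re] at h'
  have e1 : (curvAdj (curv (colA (N := N) l)) μ x).re = curvAdj (curv (fun κ z => wH (N := N) κ l z)) μ x := by
    have := congr_fun (congr_fun (re1_curvAdj (curv (colA (N := N) l))) μ) x
    rw [re2_curv, re1_colA] at this
    simpa using this
  have e2 : (adjContourSum N (colφ (N := N) l) μ x).re = contourSumAdj N (fun κ y => wΦ (N := N) κ l y) μ x := by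
    have := congr_fun (congr_fun (re1_adjContourSum (N := N) (colφ (N := N) l)) μ) x
    rw [re1_colφ] at this
    simpa using this
  have e3 : (dz (codiff₁ (dz (colμ (N := N) l))) μ x).re = dz (codiff₁ (dz (wM (N := N) l))) μ x := by
    have := congr_fun (congr_fun (re1_dz (codiff₁ (dz (colμ (N := N) l)))) μ) x
    rw [re0_codiff₁, re1_dz (colμ (N := N) l), re0_colμ] at this
    simpa using this
  rw [← e1, ← e2, ← e3]
  exact h'

/-- REAL COLUMN IDENTITY (G): block-constancy of the real gauge quantity, in the `toSite` coordinates of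
`AffineReproduction.IsBlockConst`. [folklore] -/
theorem wH_G (l : Fin (d + 1)) (y : AffineAveraging.Site (d + 1)) {b : Fin (d + 1) → ℕ} (hb : b ∈ box (d + 1) N) :
    codiff₁ (dz (codiff₁ (fun κ z => wH (N := N) κ l z))) ((N : ℤ) • y + toSite b)
      = codiff₁ (dz (codiff₁ (fun κ z => wH (N := N) κ l z))) ((N : ℤ) • y) := by
  have hre : ∀ x, codiff₁ (dz (codiff₁ (fun κ z => wH (N := N) κ l z))) x
      = (codiff₁ (dz (codiff₁ (colA (N := N) l))) x).re := by
    intro x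
    have := congr_fun (re0_codiff₁ (dz (codiff₁ (colA (N := N) l)))) x
    rw [re1_dz, re0_codiff₁ (colA (N := N) l), re1_colA] at this
    simpa using this.symm
  rw [hre, hre, toSite_eq_repZ_proj (N := N) hb, add_comm ((N : ℤ) • y), colA_G]

/-- REAL COLUMN IDENTITY (Q): block averages `δ_{y,0} δ_{κ,l}`. [folklore] -/
theorem wH_Q (l κ : Fin (d + 1)) (y : AffineAveraging.Site (d + 1)) :
    contourSum N (fun κ z => wH (N := N) κ l z) κ y = if y = 0 ∧ κ = l then 1 else 0 := by
  have := congr_fun (congr_fun (re1_contourSum (N := N) (colA (N := N) l)) κ) y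
  rw [re1_colA] at this
  rw [← this, re1_apply, colA_Q]
  split_ifs <;> simp

end Columns

/-! ## §5 Exponential decay of the kernels and their absolutely summable second moments -/

section Decay

variable [NeZero N]

/-- `|z|₁ ≤ N · |⌊z/N⌋|₁ + N (d+1)`: the `ℓ¹` size of a point is controlled by that of its block index. [folklore] -/
theorem l1_le_l1_quo (z : AffineAveraging.Site (d + 1)) : l1 z ≤ (N : ℝ) * l1 (quo N z) + (N : ℝ) * (d + 1) := by
  have hx := eq_repZ_add_zsmul_quo (N := N) z
  have hcoord : ∀ j, |(z j : ℝ)| ≤ (N : ℝ) * |(quo N z j : ℝ)| + N := by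
    intro j
    have hj : z j = repZ (Torus.proj N z) j + (N : ℤ) * quo N z j := by
      have := congr_fun hx j
      simpa only [Pi.add_apply, Pi.smul_apply, smul_eq_mul] using this
    have h0 := repZ_nonneg (Torus.proj N z) j
    have h1 := repZ_lt (Torus.proj N z) j
    have hjR : (z j : ℝ) = (repZ (Torus.proj N z) j : ℝ) + (N : ℝ) * (quo N z j : ℝ) := by exact_mod_cast hj
    have h0R : (0 : ℝ) ≤ (repZ (Torus.proj N z) j : ℝ) := by exact_mod_cast h0
    have h1R : ((repZ (Torus.proj N z) j : ℤ) : ℝ) < (N : ℝ) := by exact_mod_cast h1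
    rw [hjR]
    calc |(repZ (Torus.proj N z) j : ℝ) + (N : ℝ) * (quo N z j : ℝ)|
        ≤ |(repZ (Torus.proj N z) j : ℝ)| + |(N : ℝ) * (quo N z j : ℝ)| := abs_add_le _ _
      _ = (repZ (Torus.proj N z) j : ℝ) + (N : ℝ) * |(quo N z j : ℝ)| := by
          rw [abs_of_nonneg h0R, abs_mul, abs_of_nonneg (Nat.cast_nonneg N)]
      _ ≤ (N : ℝ) * |(quo N z j : ℝ)| + N := by linarith
  calc l1 z = ∑ j, |(z j : ℝ)| := rfl
    _ ≤ ∑ j, ((N : ℝ) * |(quo N z j : ℝ)| + N) := Finset.sum_le_sum fun j _ => hcoord j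
    _ = (N : ℝ) * l1 (quo N z) + (N : ℝ) * (d + 1) := by
        rw [Finset.sum_add_distrib, Finset.sum_const, Finset.card_univ, Fintype.card_fin, l1, Finset.mul_sum]
        simp only [nsmul_eq_mul, Nat.cast_add, Nat.cast_one]
        ring

/-- EXPONENTIAL DECAY OF THE FUNDAMENTAL CONFIGURATIONS in the block index, uniformly in the source direction `l`,
AT FIXED `N` (the rate `δ` and constant `M` are those of `BlochFibreMatrix.invKernel_fibre_decay_l1 (N := N)` and
depend on `N`; no uniformity in `N` is claimed or needed on the qualitative route (R14-1)). [folklore] -/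
theorem fundCfg_src_decay :
    ∃ δ M : ℝ, 0 < δ ∧ 0 ≤ M ∧ ∀ (l : Fin (d + 1)) (q : AffineAveraging.Site (d + 1)) (i : Idx (d + 1) N),
      ‖fundCfg (N := N) (src l) q i‖ ≤ M * Real.exp (-(δ * l1 q)) := by
  obtain ⟨δ, M, hδ, hM, h⟩ := invKernel_fibre_decay_l1 (N := N) (d := d)
  refine ⟨δ, M, hδ, hM, fun l q i => ?_⟩
  simp only [fundCfg, mulVec_src]
  exact h i _ q

/-- From decay in the block index to decay in the fine point. [folklore] -/
theorem exp_quo_le {δ : ℝ} (hδ : 0 < δ) (z : AffineAveraging.Site (d + 1)) :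
    Real.exp (-(δ * l1 (quo N z))) ≤ Real.exp (δ * (d + 1)) * Real.exp (-(δ / N) * l1 z) := by
  have hN : (0 : ℝ) < N := by exact_mod_cast Nat.pos_of_ne_zero (NeZero.ne N)
  rw [← Real.exp_add]
  apply Real.exp_le_exp.2
  have h := l1_le_l1_quo (N := N) z
  have : δ / N * l1 z ≤ δ * l1 (quo N z) + δ * (d + 1) := by
    rw [div_mul_eq_mul_div, div_le_iff₀ hN]
    nlinarith
  linarith

/-- **DECAY OF THE FINE-FIELD KERNEL** in the cell's `Decay510` shape, uniformly in `κ, l`, AT FIXED `N`: the witnesses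
are `δ_N = δ / N` and `C_N = M · e^{δ (d+1)}` with `(δ, M)` from `invKernel_fibre_decay_l1 (N := N)` (block-index decay
transported to the fine point by `exp_quo_le`); both depend on `N` — the statement is an existential PER `N`, and no
uniformity in `N` is claimed (none is needed downstream: (R14-1) is qualitative; XREAD C-pv01-64 item (d)). [folklore] -/
theorem decay_wH : ∃ δ C : ℝ, 0 < δ ∧ ∀ κ l : Fin (d + 1), Decay510 (wH (N := N) κ l) C δ := by
  obtain ⟨δ, M, hδ, hM, h⟩ := fundCfg_src_decay (N := N) (d := d)
  have hN : (0 : ℝ) < N := by exact_mod_cast Nat.pos_of_ne_zero (NeZero.ne N)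
  refine ⟨δ / N, M * Real.exp (δ * (d + 1)), div_pos hδ hN, fun κ l z => ?_⟩
  calc |wH (N := N) κ l z| ≤ ‖colA (N := N) l κ z‖ := Complex.abs_re_le_norm _
    _ = ‖fundCfg (N := N) (src l) (quo N z) (Sum.inl (κ, Torus.proj N z))‖ := rfl
    _ ≤ M * Real.exp (-(δ * l1 (quo N z))) := h l _ _
    _ ≤ M * (Real.exp (δ * (d + 1)) * Real.exp (-(δ / N) * l1 z)) :=
        mul_le_mul_of_nonneg_left (exp_quo_le (N := N) hδ z) hM
    _ = M * Real.exp (δ * (d + 1)) * Real.exp (-(δ / N) * l1 z) := by ring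

/-- **DECAY OF THE GAUGE-MULTIPLIER KERNEL**, uniformly in `l`, AT FIXED `N` (witnesses `δ / N`, `M · e^{δ (d+1)}` as in
`decay_wH`; `N`-dependent, no uniformity in `N` claimed). [folklore] -/
theorem decay_wM : ∃ δ C : ℝ, 0 < δ ∧ ∀ l : Fin (d + 1), Decay510 (wM (N := N) l) C δ := by
  obtain ⟨δ, M, hδ, hM, h⟩ := fundCfg_src_decay (N := N) (d := d)
  have hN : (0 : ℝ) < N := by exact_mod_cast Nat.pos_of_ne_zero (NeZero.ne N)
  refine ⟨δ / N, M * Real.exp (δ * (d + 1)), div_pos hδ hN, fun l z => ?_⟩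
  calc |wM (N := N) l z| ≤ ‖colμ (N := N) l z‖ := Complex.abs_re_le_norm _
    _ = ‖fundCfg (N := N) (src l) (quo N z) (Sum.inr (Sum.inl (Torus.proj N z)))‖ := rfl
    _ ≤ M * Real.exp (-(δ * l1 (quo N z))) := h l _ _
    _ ≤ M * (Real.exp (δ * (d + 1)) * Real.exp (-(δ / N) * l1 z)) :=
        mul_le_mul_of_nonneg_left (exp_quo_le (N := N) hδ z) hM
    _ = M * Real.exp (δ * (d + 1)) * Real.exp (-(δ / N) * l1 z) := by ring

/-- **DECAY OF THE CONSTRAINT-MULTIPLIER KERNEL** (a coarse field: decay in the block index itself), AT FIXED `N`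
(witnesses `(δ, M)` of `invKernel_fibre_decay_l1 (N := N)`; `N`-dependent, no uniformity in `N` claimed). [folklore] -/
theorem decay_wΦ : ∃ δ C : ℝ, 0 < δ ∧ ∀ κ l : Fin (d + 1), Decay510 (wΦ (N := N) κ l) C δ := by
  obtain ⟨δ, M, hδ, _, h⟩ := fundCfg_src_decay (N := N) (d := d)
  refine ⟨δ, M, hδ, fun κ l y => ?_⟩
  calc |wΦ (N := N) κ l y| ≤ ‖colφ (N := N) l κ y‖ := Complex.abs_re_le_norm _
    _ = ‖fundCfg (N := N) (src l) y (Sum.inr (Sum.inr κ))‖ := rfl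
    _ ≤ M * Real.exp (-(δ * l1 y)) := h l _ _
    _ = M * Real.exp (-δ * l1 y) := by rw [neg_mul]

/-- The fine-field kernel has absolutely summable second moments. [folklore] -/
theorem absMoment₂_wH : ∀ κ l : Fin (d + 1), AbsMoment₂ (wH (N := N) κ l) := by
  obtain ⟨δ, C, hδ, h⟩ := decay_wH (N := N) (d := d)
  exact fun κ l => absMoment₂_of_decay510 hδ (h κ l)

/-- The gauge-multiplier kernel has absolutely summable second moments. [folklore] -/
theorem absMoment₂_wM : ∀ l : Fin (d + 1), AbsMoment₂ (wM (N := N) l) := by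
  obtain ⟨δ, C, hδ, h⟩ := decay_wM (N := N) (d := d)
  exact fun l => absMoment₂_of_decay510 hδ (h l)

/-- The constraint-multiplier kernel has absolutely summable second moments. [folklore] -/
theorem absMoment₂_wΦ : ∀ κ l : Fin (d + 1), AbsMoment₂ (wΦ (N := N) κ l) := by
  obtain ⟨δ, C, hδ, h⟩ := decay_wΦ (N := N) (d := d)
  exact fun κ l => absMoment₂_of_decay510 hδ (h κ l)

end Decay

/-! ## §6 The kernel operators on affine data as unconditional sums over the sources -/

section Sums

/-- The decimated (`y`-form) family of a kernel term on affine data is summable: pull the summability of the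
`z`-form family of `Beta/KernelRepresentationSummable` back along the injection `y ↦ x − N y`. [folklore] -/
theorem summable_decimated_of_isAffine {n M : ℕ} (hM : M ≠ 0) {f : (Fin n → ℤ) → ℝ} (hf : AbsMoment₂ f)
    {b : Form1 n ℝ} (hb : IsAffine b) (l : Fin n) (x : Fin n → ℤ) :
    Summable (fun y : Fin n → ℤ => f (x - (M : ℤ) • y) * b l y) := by
  have hMz : (M : ℤ) ≠ 0 := by exact_mod_cast hM
  have hs := summable_summand_of_isAffine hM hf hb l x
  have hinj : Function.Injective (fun y : Fin n → ℤ => x - (M : ℤ) • y) := by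
    intro y y' h
    have h' : (M : ℤ) • y = (M : ℤ) • y' := sub_right_injective h
    funext i
    have hi := congr_fun h' i
    simp only [Pi.smul_apply, smul_eq_mul] at hi
    exact mul_left_cancel₀ hMz hi
  have h2 := hs.comp_injective hinj
  refine h2.congr fun y => ?_
  simp only [Function.comp_apply, summand, sub_sub_cancel]
  have hind : cosetInd M ((M : ℤ) • y) = 1 := by
    unfold cosetInd
    rw [if_pos]
    intro i
    exact ⟨y i, by simp⟩
  have hq : (fun i => ((M : ℤ) • y) i / (M : ℤ)) = y := by
    funext i
    simp only [Pi.smul_apply, smul_eq_mul]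
    exact Int.mul_ediv_cancel_left _ hMz
  rw [hind, hq, one_smul]

/-- **THE KERNEL OPERATOR ON AFFINE DATA IS THE SUM OVER THE SOURCES** `(l, y)` of `w_{κl}(x − N y) · b_l(y)`
(the inner sum over `l` finite, the outer one over `y ∈ ℤ^n` unconditional). [folklore] -/
theorem hasSum_kernelOpSum {n M : ℕ} (hM : M ≠ 0) (w : Fin n → Fin n → (Fin n → ℤ) → ℝ)
    (hw : ∀ κ l, AbsMoment₂ (w κ l)) {b : Form1 n ℝ} (hb : IsAffine b) (κ : Fin n) (x : Fin n → ℤ) :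
    HasSum (fun y : Fin n → ℤ => ∑ l, w κ l (x - (M : ℤ) • y) * b l y) (kernelOpSum M w b κ x) := by
  rw [kernelOpSum_apply_eq_decimated hM]
  exact hasSum_sum fun l _ => (summable_decimated_of_isAffine hM (hw κ l) hb l x).hasSum

variable [NeZero N]

/-- THE FINE FIELD `H b := kernelOpSum N wH b`. [folklore] -/
def Hop (b : Form1 (d + 1) ℝ) : Form1 (d + 1) ℝ := kernelOpSum N (wH (N := N)) b

/-- THE CONSTRAINT MULTIPLIER `Φ b := kernelOpSum 1 wΦ b` (a coarse-to-coarse convolution). [folklore] -/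
def Φop (b : Form1 (d + 1) ℝ) : Form1 (d + 1) ℝ := kernelOpSum 1 (wΦ (N := N)) b

/-- THE GAUGE-MULTIPLIER POTENTIAL `M b := kernelOpSum N wM b` (a 0-form; the row index is spurious). [folklore] -/
def Mop (b : Form1 (d + 1) ℝ) : Form0 (d + 1) ℝ := fun x => kernelOpSum N (fun _ l => wM (N := N) l) b 0 x

/-- THE GAUGE MULTIPLIER `Ψ b := δ d (M b)`. [folklore] -/
def Ψop (b : Form1 (d + 1) ℝ) : Form0 (d + 1) ℝ := codiff₁ (dz (Mop (N := N) b))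

/-- `H b` as the sum over the sources. [folklore] -/
theorem hasSum_Hop {b : Form1 (d + 1) ℝ} (hb : IsAffine b) (κ : Fin (d + 1)) (x : AffineAveraging.Site (d + 1)) :
    HasSum (fun y : AffineAveraging.Site (d + 1) => ∑ l, wH (N := N) κ l (x - (N : ℤ) • y) * b l y) (Hop (N := N) b κ x) :=
  hasSum_kernelOpSum (NeZero.ne N) _ absMoment₂_wH hb κ x

/-- `Φ b` as the sum over the sources. [folklore] -/
theorem hasSum_Φop {b : Form1 (d + 1) ℝ} (hb : IsAffine b) (κ : Fin (d + 1)) (q : AffineAveraging.Site (d + 1)) :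
    HasSum (fun y : AffineAveraging.Site (d + 1) => ∑ l, wΦ (N := N) κ l (q - y) * b l y) (Φop (N := N) b κ q) := by
  have h := hasSum_kernelOpSum one_ne_zero _ (absMoment₂_wΦ (N := N)) hb κ q
  simp only [Nat.cast_one, one_smul] at h
  exact h

/-- `M b` as the sum over the sources. [folklore] -/
theorem hasSum_Mop {b : Form1 (d + 1) ℝ} (hb : IsAffine b) (x : AffineAveraging.Site (d + 1)) :
    HasSum (fun y : AffineAveraging.Site (d + 1) => ∑ l, wM (N := N) l (x - (N : ℤ) • y) * b l y) (Mop (N := N) b x) :=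
  hasSum_kernelOpSum (NeZero.ne N) (fun _ l => wM (N := N) l) (fun _ l => absMoment₂_wM l) hb 0 x

end Sums

/-! ## §7 The three equations of the spec, by superposition of the column identities -/

section Equations

variable [NeZero N]

/-- **(Q_H) REPRODUCTION OF AFFINE BLOCK AVERAGES**: `𝒬 (H b) = b`. [folklore] -/
theorem Q_Hop {b : Form1 (d + 1) ℝ} (hb : IsAffine b) : contourSum N (Hop (N := N) b) = b := by
  funext κ y'
  have h1 : HasSum (fun y : AffineAveraging.Site (d + 1) =>
      contourSum N (fun κ' z => ∑ l, wH (N := N) κ' l (z - (N : ℤ) • y) * b l y) κ y') (contourSum N (Hop (N := N) b) κ y') :=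
    hasSum_contourSum (fun κ' z => hasSum_Hop hb κ' z) κ y'
  have h2 : ∀ y : AffineAveraging.Site (d + 1),
      contourSum N (fun κ' z => ∑ l, wH (N := N) κ' l (z - (N : ℤ) • y) * b l y) κ y' = if y = y' then b κ y' else 0 := by
    intro y
    have hs := op₁₁_superpos (opQ N) (fun l κ' z => wH (N := N) κ' l (z - (N : ℤ) • y)) (fun l => b l y) κ y'
    simp only [opQ_apply] at hs
    rw [hs]
    have ht : ∀ l, contourSum N (fun κ' z => wH (N := N) κ' l (z - (N : ℤ) • y)) κ y'
        = if y' - y = 0 ∧ κ = l then 1 else 0 := fun l => by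
      rw [contourSum_shift (fun κ' z => wH (N := N) κ' l z) y κ y', wH_Q]
    simp only [ht, mul_ite, mul_one, mul_zero]
    by_cases hy : y = y'
    · subst hy
      simp
    · have : ¬ (y' - y = 0) := fun h => hy (sub_eq_zero.1 h).symm
      simp [this, hy]
  simp only [h2] at h1
  exact h1.unique (hasSum_ite_eq y' (b κ y'))

/-- **(EL) THE EULER–LAGRANGE EQUATION** `d*d (H b) = 𝒬ᵀ (Φ b) + d (Ψ b)`. [folklore] -/
theorem EL_Hop {b : Form1 (d + 1) ℝ} (hb : IsAffine b) :
    curvAdj (curv (Hop (N := N) b)) = contourSumAdj N (Φop (N := N) b) + dz (Ψop (N := N) b) := by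
  funext μ x
  have hL : HasSum (fun y : AffineAveraging.Site (d + 1) =>
      curvAdj (curv (fun κ z => ∑ l, wH (N := N) κ l (z - (N : ℤ) • y) * b l y)) μ x)
      (curvAdj (curv (Hop (N := N) b)) μ x) :=
    hasSum_curvAdj (fun κ l z => hasSum_curv (fun κ z => hasSum_Hop hb κ z) κ l z) μ x
  have hΦ : HasSum (fun y : AffineAveraging.Site (d + 1) =>
      contourSumAdj N (fun κ q => ∑ l, wΦ (N := N) κ l (q - y) * b l y) μ x) (contourSumAdj N (Φop (N := N) b) μ x) :=
    hasSum_contourSumAdj (fun κ q => hasSum_Φop hb κ q) μ x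
  have hΨ : HasSum (fun y : AffineAveraging.Site (d + 1) =>
      dz (codiff₁ (dz (fun z => ∑ l, wM (N := N) l (z - (N : ℤ) • y) * b l y))) μ x) (dz (Ψop (N := N) b) μ x) :=
    hasSum_dz (fun z => hasSum_codiff₁ (fun κ z => hasSum_dz (fun z => hasSum_Mop hb z) κ z) z) μ x
  have hterm : ∀ y : AffineAveraging.Site (d + 1),
      curvAdj (curv (fun κ z => ∑ l, wH (N := N) κ l (z - (N : ℤ) • y) * b l y)) μ x
        = contourSumAdj N (fun κ q => ∑ l, wΦ (N := N) κ l (q - y) * b l y) μ x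
          + dz (codiff₁ (dz (fun z => ∑ l, wM (N := N) l (z - (N : ℤ) • y) * b l y))) μ x := by
    intro y
    have s1 := op₁₁_superpos opEL (fun l κ z => wH (N := N) κ l (z - (N : ℤ) • y)) (fun l => b l y) μ x
    have s2 := op₁₁_superpos (opΦ N) (fun l κ q => wΦ (N := N) κ l (q - y)) (fun l => b l y) μ x
    have s3 := op₀₁_superpos opM (fun l z => wM (N := N) l (z - (N : ℤ) • y)) (fun l => b l y) μ x
    simp only [opEL_apply, opΦ_apply, opM_apply] at s1 s2 s3
    rw [s1, s2, s3, ← Finset.sum_add_distrib]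
    refine Finset.sum_congr rfl fun l _ => ?_
    rw [← mul_add, opEL_shift (fun κ z => wH (N := N) κ l z) ((N : ℤ) • y) μ x, wH_EL,
      contourSumAdj_shift (fun κ q => wΦ (N := N) κ l q) y μ x, opM_shift (wM (N := N) l) ((N : ℤ) • y) μ x]
  simp only [hterm] at hL
  have := hL.unique (hΦ.add hΨ)
  simpa only [Pi.add_apply] using this

/-- **(gauge) THE GAUGE QUANTITY `δdδ (H b)` IS BLOCK-CONSTANT**. [folklore] -/
theorem gauge_Hop {b : Form1 (d + 1) ℝ} (hb : IsAffine b) :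
    IsBlockConst N (codiff₁ (dz (codiff₁ (Hop (N := N) b)))) := by
  intro y bb hbb
  have hG : ∀ x : AffineAveraging.Site (d + 1), HasSum (fun y'' : AffineAveraging.Site (d + 1) =>
      codiff₁ (dz (codiff₁ (fun κ z => ∑ l, wH (N := N) κ l (z - (N : ℤ) • y'') * b l y''))) x)
      (codiff₁ (dz (codiff₁ (Hop (N := N) b))) x) := fun x =>
    hasSum_codiff₁ (fun κ z => hasSum_dz (fun z => hasSum_codiff₁ (fun κ z => hasSum_Hop hb κ z) z) κ z) x
  have hterm : ∀ y'' : AffineAveraging.Site (d + 1),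
      codiff₁ (dz (codiff₁ (fun κ z => ∑ l, wH (N := N) κ l (z - (N : ℤ) • y'') * b l y''))) ((N : ℤ) • y + toSite bb)
        = codiff₁ (dz (codiff₁ (fun κ z => ∑ l, wH (N := N) κ l (z - (N : ℤ) • y'') * b l y''))) ((N : ℤ) • y) := by
    intro y''
    have s1 := op₁₀_superpos opG (fun l κ z => wH (N := N) κ l (z - (N : ℤ) • y'')) (fun l => b l y'')
      ((N : ℤ) • y + toSite bb)
    have s2 := op₁₀_superpos opG (fun l κ z => wH (N := N) κ l (z - (N : ℤ) • y'')) (fun l => b l y'')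
      ((N : ℤ) • y)
    simp only [opG_apply] at s1 s2
    rw [s1, s2]
    refine Finset.sum_congr rfl fun l _ => ?_
    rw [opG_shift (fun κ z => wH (N := N) κ l z) ((N : ℤ) • y'') ((N : ℤ) • y + toSite bb),
      opG_shift (fun κ z => wH (N := N) κ l z) ((N : ℤ) • y'') ((N : ℤ) • y),
      show (N : ℤ) • y + toSite bb - (N : ℤ) • y'' = (N : ℤ) • (y - y'') + toSite bb by rw [smul_sub]; abel,
      show (N : ℤ) • y - (N : ℤ) • y'' = (N : ℤ) • (y - y'') by rw [smul_sub], wH_G (N := N) l (y - y'') hbb]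
  have h1 := hG ((N : ℤ) • y + toSite bb)
  simp only [hterm] at h1
  exact h1.unique (hG ((N : ℤ) • y))

end Equations

/-! ## §8 The instance -/

section Instance

variable [NeZero N]

/-- `M` is additive on affine data. [folklore] -/
theorem Mop_add {b b' : Form1 (d + 1) ℝ} (hb : IsAffine b) (hb' : IsAffine b') :
    Mop (N := N) (b + b') = Mop (N := N) b + Mop (N := N) b' := by
  funext x
  have h := kernelOpSum_add (NeZero.ne N) (fun (_ : Fin (d + 1)) l => wM (N := N) l) (fun _ l => absMoment₂_wM l) hb hb'
  have := congr_fun (congr_fun h 0) x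
  simpa only [Mop, Pi.add_apply] using this

/-- `M` is block-translation covariant. [folklore] -/
theorem Mop_trans1 (b : Form1 (d + 1) ℝ) (a : AffineAveraging.Site (d + 1)) :
    Mop (N := N) (trans1 a b) = fun x => Mop (N := N) b (x + (N : ℤ) • a) := by
  funext x
  have h := kernelOpSum_trans1 (NeZero.ne N) (fun (_ : Fin (d + 1)) l => wM (N := N) l) a b
  have := congr_fun (congr_fun h 0) x
  simpa only [Mop, trans1_apply] using this

/-- `δ d` commutes with translations (`+ v` form, pointwise). [folklore] -/
theorem codiff₁_dz_translate (f : Form0 (d + 1) ℝ) (v : AffineAveraging.Site (d + 1)) (x : AffineAveraging.Site (d + 1)) :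
    codiff₁ (dz (fun z => f (z + v))) x = codiff₁ (dz f) (x + v) := by
  have h1 : (fun z => f (z + v)) = fun z => f (z - (-v)) := by funext z; rw [sub_neg_eq_add]
  rw [h1, dz_shift, codiff₁_shift]
  simp only [sub_neg_eq_add]

/-- **THE KERNEL-REPRESENTED INFINITE-VOLUME SPEC** — all nine fields of `AffineReproduction.InfiniteVolumeSpec`
for `H := kernelOpSum N wH`, `Φ := kernelOpSum 1 wΦ`, `Ψ := δ d (kernelOpSum N wM)`. [folklore] -/
def specK : InfiniteVolumeSpec (d + 1) N where
  H := Hop (N := N)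
  Φ := Φop (N := N)
  Ψ := Ψop (N := N)
  H_add := kernelOpSum_H_add (NeZero.ne N) (wH (N := N)) absMoment₂_wH
  Φ_add := fun b b' hb hb' => kernelOpSum_H_add (N := 1) one_ne_zero (wΦ (N := N)) absMoment₂_wΦ b b' hb hb'
  Ψ_add := fun b b' hb hb' => by
    show codiff₁ (dz (Mop (N := N) (b + b'))) = codiff₁ (dz (Mop (N := N) b)) + codiff₁ (dz (Mop (N := N) b'))
    rw [Mop_add hb hb', AffineReproduction.dz_add, codiff₁_add]
  H_cov := kernelOpSum_H_cov (NeZero.ne N) (wH (N := N))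
  Φ_cov := fun b a _ => by
    have h := kernelOpSum_trans1 (N := 1) one_ne_zero (wΦ (N := N)) a b
    simp only [Nat.cast_one, one_smul] at h
    exact h
  Ψ_cov := fun b a _ => by
    show codiff₁ (dz (Mop (N := N) (trans1 a b))) = trans0 ((N : ℤ) • a) (codiff₁ (dz (Mop (N := N) b)))
    funext x
    rw [Mop_trans1, trans0_apply, codiff₁_dz_translate]
  Q_H := fun _ hb => Q_Hop hb
  EL := fun _ hb => EL_Hop hb
  gauge := fun _ hb => gauge_Hop hb

/-- The fine-field map of `specK` IS the kernel operator of `wH` (by `rfl`): the representation hypothesis `hrep` of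
`KernelRepresentationSummable.lowMomentsSum_of_spec` / `decimatedSum_second_moment_of_spec`. [folklore] -/
theorem specK_H : (specK (N := N) (d := d)).H = kernelOpSum N (wH (N := N)) := rfl

/-- The constraint-multiplier map of `specK`. [folklore] -/
theorem specK_Φ : (specK (N := N) (d := d)).Φ = fun b => kernelOpSum 1 (wΦ (N := N)) b := rfl

/-- The gauge-multiplier map of `specK`. [folklore] -/
theorem specK_Ψ : (specK (N := N) (d := d)).Ψ = fun b => codiff₁ (dz (Mop (N := N) b)) := rfl

/-- **END TO END — THE WINDOWED LOW MOMENTS OF THE KERNEL OF THE TYPED KKT SOLUTION OPERATOR.**  The fine-field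
kernel `wH` of the solution operator of the TYPED `U = 1` block-averaging KKT system
(`AffineReproduction.InfiniteVolumeSpec`) satisfies (L0∞) `ConstReproSum N (wH κ l) (δ_{κl} / N^{d+2})` and (L1∞)
`∃ C, LinReproSum N (wH κ l) C` — `KernelRepresentationSummable.lowMomentsSum_of_spec` applied to the constructed
instance; no hypothesis remains. [folklore] -/
theorem lowMomentsSum_specK :
    (∀ κ l : Fin (d + 1), ConstReproSum N (wH (N := N) κ l) (if κ = l then ((N : ℝ) ^ (d + 1 + 1))⁻¹ else 0))
      ∧ ∀ κ l : Fin (d + 1), ∃ C : Fin (d + 1) → ℝ, LinReproSum N (wH (N := N) κ l) C :=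
  lowMomentsSum_of_spec (specK (N := N)) (wH (N := N)) absMoment₂_wH rfl

/-- EXISTENCE FORM (the shape consumed downstream): a spec, a kernel with absolutely summable second moments and
exponential decay uniform in `κ, l` (rate and constant depending on the FIXED `N`; nothing uniform in `N` is claimed),
and the representation identity. [folklore] -/
theorem exists_kernelSpec :
    ∃ (S : InfiniteVolumeSpec (d + 1) N) (w : Fin (d + 1) → Fin (d + 1) → AffineAveraging.Site (d + 1) → ℝ),
      (∀ κ l, AbsMoment₂ (w κ l)) ∧ (∃ δ C : ℝ, 0 < δ ∧ ∀ κ l, Decay510 (w κ l) C δ) ∧ S.H = kernelOpSum N w :=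
  ⟨specK, wH, absMoment₂_wH, decay_wH, rfl⟩

end Instance

end Literature.MathematicalPhysics.QuantumFieldTheory.Balaban1983to89.Beta.KernelSpecInstance

end
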